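import Summits.ResolutionOfSingularities.ResolutionOfSingularities.Theorems.HomologicalConductorNoZenoRationalAscentNormalModel
import Summits.ResolutionOfSingularities.ResolutionOfSingularities.Theorems.HomologicalConductorNoZenoRationalAscentFiniteFibre
import Summits.ResolutionOfSingularities.ResolutionOfSingularities.Theorems.HomologicalConductorNoZenoRationalAscentInfiniteFibreLocus
import Literature.AlgebraicGeometry.Morphisms.FinsetInAffineOpenOfProjective
import HarnessLib

/-!
# Crux `NoZenoR` (stmt-ResolutionOfSingularities-19943) — **the print `Lipman1969_1_2` FOLLOWS FROM statement B)**: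
# `Lipman1969_1_2_of_B : Lipman1969_1_2_B → Lipman1969_1_2`

Route `ResolutionOfSingularities/HomologicalConductor` (cell decomp-res, hand leafhand-res-homologicalconduct-12 g1).
OURS: AI-written, weaker than expert review; nothing here is a statement of the manuscript under review (Hironaka 2017).
SUPPORT level (`--supports stmt-19943`), counted 0.  Def-free.  Named fact consumed: ONLY the hypothesis
`(hB : Lipman1969_1_2_B)` (statement B) of Lipman's proof of (1.2) = a special case of Zariski's Theorem (26.1), typed by hand
leafhand-res-homologicalconduct-11 in `Resolution/Lipman1969DominationByQuadraticTransforms`).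

Lipman's Proposition (1.2) (Publ. IHÉS 36, p. 199) as vendored (`Resolution/Lipman1969RationalSurfaceSingularities.Lipman1969_1_2`):
for `R` a two-dimensional normal local ring with a rational singularity and `g : W → Spec R` birational of finite type
(`W` integral; locally of finite type, quasi-compact, separated), 1) every normal point of codimension two of `W` has a
rational singularity, 2) if `W` is normal and `g` proper then `H¹(W, 𝒪_W) = 0`.  Part 2) modulo B) is hand 11's
`Lipman1969_1_2_B.hasTrivialCechH1_of_isProper`; part 1) modulo B) is proved here in Lipman's own way (p. 200 with footnote (1)):
restrict to an affine open `U ∋ w` (still birational over `R`, `isBirational_ι_comp`), pass to a PROJECTIVE model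
(`exists_projectiveModel_of_isAffine`), dominate by `h : Z → W*` using B) (`H¹(Z, 𝒪_Z) = 0` by 2)), and conclude by the Čech
form of «`H²(W*, h_*𝒪_Z) = 0` (EGA III (4.2.2)) + `R¹h_*𝒪_Z` supported in dimension `0`»: the projective Görtz–Wedhorn 24.44
(p613816) inside `hasRationalSingularity_of_chart_of_forall_stalk`, the finiteness of the infinite-fibre locus
(`finite_setOf_infinite_preimage`) and Zariski's Main Theorem off it (`hasTrivialCechH1_pullback_snd_fromSpecStalk_of_finite_preimage`).
Normality and dimension of the point are not even needed for 1).

* `isBirational_ι_comp` — a birational morphism from an integral scheme stays birational on every non-empty open of the source;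
* `hasRationalSingularity_stalk_of_isAffine_of_B` — 1) for an affine birational model, at every point, mod B);
* **`Lipman1969_1_2_of_B : Lipman1969_1_2_B.{0} → Lipman1969_1_2.{0}`**.

Consequence for the W4.4 chain: every consumer of `(h12 : Lipman1969_1_2)` can be fed `Lipman1969_1_2_of_B hB`; the eleven-print
residual of `stub_publishedSurfaceFactsW3` and the four-print residual of the kill-test / crux doors lose `Lipman1969_1_2` in favour
of `Lipman1969_1_2_B` (Zariski's Theorem (26.1), special case; owned by the D-0154 «(1.2) 2-reg» cell).
No crux, kill test or summit statement is proved; resolution of singularities in positive characteristic is NOT proved.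

## References
* J. Lipman, *Rational singularities …*, Publ. Math. IHÉS 36 (1969): Prop. (1.2) and its proof, pp. 199–200 with footnote (1);
  statement B) (p. 200); Theorem (26.1) (p. 274). [Lipman1969]
* The Stacks Project, Tag 02UP. [StacksProject]
-/

-- single-problem summit: the doubled namespace component `ResolutionOfSingularities` is forced
set_option linter.dupNamespace false

noncomputable section

namespace Summit.ResolutionOfSingularities.ResolutionOfSingularities.Theorems.NoZeno.RationalAscent

open CategoryTheory CategoryTheory.Limits AlgebraicGeometry TopologicalSpace IsLocalRing
open Literature.AlgebraicGeometry.Resolution Literature.AlgebraicGeometry.Morphisms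
open Summit.ResolutionOfSingularities.ResolutionOfSingularities.Theorems.SurfaceTermination.GenusDescent
open Summit.ResolutionOfSingularities.ResolutionOfSingularities.Theorems.NoZeno.SandwichCluster

/-! ## Birationality of the restriction to an open of the source -/

/-- **A birational morphism from an irreducible scheme stays birational on every non-empty open of the source**: if `g` is an
isomorphism over the dense open `V`, then `U ↪ W → X` is an isomorphism over the image `V'` of `U ∩ g⁻¹V` in `V`. [folklore] -/
theorem isBirational_ι_comp {W X : Scheme.{0}} [IsIntegral W] [IrreducibleSpace X] {g : W ⟶ X}
    (hg : IsBirational g) (U : W.Opens) (hU : ((U : Set W)).Nonempty) : IsBirational (U.ι ≫ g) := by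
  obtain ⟨V, hV, hV', hiso⟩ := hg
  haveI := hiso
  haveI : Nonempty ↥((U : W.Opens) : Scheme.{0}) := ⟨(⟨hU.choose, hU.choose_spec⟩ : U)⟩
  haveI : IsIntegral ((U : W.Opens) : Scheme.{0}) := isIntegral_of_isOpenImmersion U.ι
  -- the open `O = U ∩ g⁻¹V` of `g⁻¹V` and its image `V' ⊆ V ⊆ X` under the isomorphism `g|_V`
  let O : ((g ⁻¹ᵁ V : W.Opens) : Scheme.{0}).Opens := (g ⁻¹ᵁ V).ι ⁻¹ᵁ U
  let V' : X.Opens := V.ι ''ᵁ ((g ∣_ V) ''ᵁ O)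
  have hV'V : V' ≤ V := by
    rintro x ⟨v, -, rfl⟩
    exact v.2
  -- `g⁻¹ V' = U ∩ g⁻¹ V`
  have hpre : ∀ z : W, z ∈ g ⁻¹ᵁ V' ↔ z ∈ U ∧ z ∈ g ⁻¹ᵁ V := by
    intro z
    constructor
    · rintro ⟨v, ⟨o, ho, hov⟩, hvz⟩
      have hzV : z ∈ g ⁻¹ᵁ V := by
        show g z ∈ V
        rw [← hvz]; exact v.2
      have h1 : (g ∣_ V) ⟨z, hzV⟩ = v := Subtype.ext (by rw [morphismRestrict_base_coe]; exact hvz.symm)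
      have h2 : o = ⟨z, hzV⟩ := (g ∣_ V).isOpenEmbedding.injective (hov.trans h1.symm)
      refine ⟨?_, hzV⟩
      have hoU : ((g ⁻¹ᵁ V).ι o : W) ∈ U := ho
      rw [h2] at hoU
      exact hoU
    · rintro ⟨hzU, hzV⟩
      refine ⟨(g ∣_ V) ⟨z, hzV⟩, ⟨⟨z, hzV⟩, hzU, rfl⟩, ?_⟩
      change V.ι ((g ∣_ V) ⟨z, hzV⟩) = g z
      rw [← Scheme.Hom.comp_apply, morphismRestrict_ι, Scheme.Hom.comp_apply]
      rfl
  -- a point of `U ∩ g⁻¹V`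
  obtain ⟨z₀, hz₀U, hz₀V⟩ := hV'.inter_open_nonempty (U : Set W) U.2 hU
  have hz₀ : z₀ ∈ g ⁻¹ᵁ V' := (hpre z₀).mpr ⟨hz₀U, hz₀V⟩
  refine ⟨V', V'.2.dense ⟨g z₀, hz₀⟩, ?_, ?_⟩
  · -- the preimage `U ∩ g⁻¹V'` is a non-empty open of the irreducible `U`
    refine ((U.ι ≫ g) ⁻¹ᵁ V').2.dense ⟨⟨z₀, hz₀U⟩, ?_⟩
    show g (U.ι ⟨z₀, hz₀U⟩) ∈ V'
    exact hz₀
  · -- `(U ↪ W → X)|_{V'} = (U ↪ W)|_{g⁻¹V'} ≫ g|_{V'}`, an open immersion onto followed by an isomorphism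
    haveI : IsIso (g ∣_ V') := isIso_morphismRestrict_of_le g hV'V
    have hsurj : Function.Surjective (U.ι ∣_ g ⁻¹ᵁ V') := by
      rintro ⟨z, hz⟩
      have hzU : z ∈ U := ((hpre z).mp hz).1
      refine ⟨⟨⟨z, hzU⟩, show (U.ι ⟨z, hzU⟩ : W) ∈ g ⁻¹ᵁ V' from hz⟩, Subtype.ext ?_⟩
      rw [morphismRestrict_base_coe]
      rfl
    haveI : Epi (U.ι ∣_ g ⁻¹ᵁ V').base := (TopCat.epi_iff_surjective _).mpr hsurj
    haveI : IsIso (U.ι ∣_ g ⁻¹ᵁ V') := IsOpenImmersion.isIso _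
    have hcomp : IsIso ((U.ι ∣_ g ⁻¹ᵁ V') ≫ (g ∣_ V')) := IsIso.comp_isIso
    rw [← morphismRestrict_comp] at hcomp
    exact hcomp

/-! ## Part 1) for an affine birational model, at every point -/

/-- **Lipman (1.2) 1) for an AFFINE birational model, at EVERY point, MODULO B).**  `R` a two-dimensional normal Noetherian
local domain with a rational singularity, `Y` affine integral, `g : Y → Spec R` locally of finite type and birational,
`y ∈ Y`: `𝒪_{Y,y}` has a rational singularity (a desingularization with `H¹ = 0`).  Lipman's proof (p. 200, footnote (1)) in
Čech form, see the module docstring. [cite: Lipman1969, Proposition (1.2) 1), proof p. 200 with footnote (1); statement B)]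
[cite: StacksProject, Tag 02UP] -/
theorem hasRationalSingularity_stalk_of_isAffine_of_B (hB : Lipman1969_1_2_B.{0}) {R : Type}
    [CommRing R] [IsNoetherianRing R] [IsLocalRing R] [IsDomain R] [IsIntegrallyClosed R]
    (hdimR : ringKrullDim R = 2) (hratR : HasRationalSingularity R)
    {Y : Scheme.{0}} [IsAffine Y] [IsIntegral Y] (g : Y ⟶ Spec (.of R)) [LocallyOfFiniteType g]
    (hbir : IsBirational g) (y : Y) : HasRationalSingularity (Y.presheaf.stalk y) := by
  classical
  haveI : IsNoetherianRing (CommRingCat.of R) := ‹IsNoetherianRing R›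
  haveI : IsLocalRing (CommRingCat.of R) := ‹IsLocalRing R›
  haveI : IsDomain (CommRingCat.of R) := ‹IsDomain R›
  -- the projective model
  obtain ⟨W, hWint, j, hj, gW, hgW, hjg, hproj, hbirW⟩ := exists_projectiveModel_of_isAffine g hbir
  haveI := hWint
  haveI := hj
  haveI := hgW
  haveI : W.IsSeparated := ⟨by rw [← terminal.comp_from gW]; infer_instance⟩
  haveI : IsLocallyNoetherian W := LocallyOfFiniteType.isLocallyNoetherian gW
  haveI : CompactSpace W := QuasiCompact.compactSpace_of_compactSpace gW
  haveI : IsNoetherian W := {}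
  -- statement B) on a desingularization of the rational `R`: `h : Z → W` with `H¹(Z, 𝒪_Z) = 0`
  obtain ⟨X, fX, hfX, -⟩ := id hratR
  obtain ⟨Z, jZ, h, hjZ, hfac⟩ := hB R hdimR X fX hfX W gW hbirW
  haveI : IsProper jZ := hjZ.isProper
  haveI : IsProper fX := hfX.isProper
  have hres : IsResolution (jZ ≫ fX) := ⟨inferInstance, hjZ.isBirational.comp hfX.isBirational, hjZ.isRegular⟩
  have hZ0 : HasTrivialCechH1 (jZ ≫ fX) :=
    Lipman1969_1_2_B.hasTrivialCechH1_of_isResolution hB hdimR hratR _ hres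
  have hZ : HasTrivialCechH1 (h ≫ gW) := by rw [hfac]; exact hZ0
  haveI : IsProper (h ≫ gW) := by rw [hfac]; infer_instance
  haveI : IsProper h := IsProper.of_comp h gW
  haveI : IsIntegral Z := hres.isIntegral_source
  haveI : IsLocallyNoetherian Z := LocallyOfFiniteType.isLocallyNoetherian (h ≫ gW)
  haveI : CompactSpace Z := QuasiCompact.compactSpace_of_compactSpace (h ≫ gW)
  haveI : IsNoetherian Z := {}
  have hbirh : IsBirational h := isBirational_of_comp' hbirW (by rw [hfac]; exact hres.isBirational)
  have hZreg : Scheme.IsRegular Z := hjZ.isRegular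
  have hdimSpecR : topologicalKrullDim (Spec (.of R)) ≤ 2 := by
    change topologicalKrullDim (PrimeSpectrum R) ≤ 2
    rw [PrimeSpectrum.topologicalKrullDim_eq_ringKrullDim]
    exact hdimR.le
  have hdimZ : topologicalKrullDim Z ≤ 2 := by
    rw [← hfac] at hres
    exact hres.isBirational.topologicalKrullDim_le_of_isNoetherian.trans hdimSpecR
  -- «`R¹h_*𝒪_Z` has support of dimension `≤ 0`»: the infinite-fibre locus `S` is a finite set of closed points
  set S : Set W := {x : W | (h ⁻¹' {x}).Infinite} with hSdef
  have hSfin : S.Finite := finite_setOf_infinite_preimage h hbirh hdimZ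
  have hSc : ∀ x ∈ S, IsClosed ({x} : Set W) := fun x hx => isClosed_singleton_of_infinite_preimage h hbirh hdimZ hx
  -- an affine open `W₀ ⊇ S ∪ {j y}` of the projective `W`
  obtain ⟨n, ι, hι⟩ := id hproj
  letI : GradedRing (MvPolynomial.homogeneousSubmodule (Fin (n + 1)) R) := MvPolynomial.gradedAlgebra
  let q : W ⟶ Proj (MvPolynomial.homogeneousSubmodule (Fin (n + 1)) R) := ι.left
  haveI : IsClosedImmersion q := hι
  haveI hqaff : IsAffineHom q := inferInstance
  obtain ⟨W₀, hW₀, hmem⟩ := exists_isAffineOpen_forall_mem_of_isAffineHom_toProj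
    (MvPolynomial.homogeneousSubmodule (Fin (n + 1)) R) q (insert (j y) hSfin.toFinset)
  have hwW₀ : j y ∈ W₀ := hmem _ (Finset.mem_insert_self _ _)
  have hSW₀ : S ⊆ (W₀ : Set W) := fun x hx =>
    hmem x (Finset.mem_insert_of_mem (hSfin.mem_toFinset.mpr hx))
  -- the good cover `{W₀} ∪ {W_b ⊆ W ∖ S}`
  obtain ⟨α, _, a₀, Wc, hWa₀, hWaff, hWcov, hdisj⟩ := exists_affineCover_eq_and_disjoint W₀ hW₀ S hSfin hSc hSW₀
  subst hWa₀
  have hW₀' : IsAffineOpen (Wc a₀) := hWaff a₀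
  -- off `S` the fibres are finite, so `R¹h_*𝒪_Z = 0` there (Zariski's Main Theorem)
  have hpt : ∀ b, b ≠ a₀ → ∀ x ∈ Wc a₀ ⊓ Wc b, HasTrivialCechH1 (pullback.snd h (W.fromSpecStalk x)) := by
    intro b hb x hx
    have hxS : x ∉ S := fun hxS => Set.disjoint_left.mp (hdisj b hb) hxS hx.2
    have hfin : (h ⁻¹' {x}).Finite := Set.not_infinite.mp hxS
    exact hasTrivialCechH1_pullback_snd_fromSpecStalk_of_finite_preimage h x hfin
  -- the chart `σ : h⁻¹W₀ → W₀ ≅ Spec Γ(W, W₀)` and its structure map over `R`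
  let N : Type := Γ(W, Wc a₀)
  haveI : Nonempty ↥(Wc a₀) := ⟨⟨j y, hwW₀⟩⟩
  let φ : CommRingCat.of R ⟶ Γ(W, Wc a₀) := Spec.preimage (hW₀'.fromSpec ≫ gW)
  letI : Algebra R N := φ.hom.toAlgebra
  let σ : ((h ⁻¹ᵁ Wc a₀ : Z.Opens) : Scheme.{0}) ⟶ Spec (.of N) := (h ∣_ Wc a₀) ≫ hW₀'.isoSpec.hom
  have hσ : IsResolution σ := by
    have h1 : IsResolution (h ∣_ Wc a₀) := IsResolution.morphismRestrict ⟨inferInstance, hbirh, hZreg⟩ (Wc a₀)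
    haveI := h1.isProper
    exact ⟨inferInstance, h1.isBirational.comp_iso _, h1.isRegular⟩
  have hσT : (h ⁻¹ᵁ Wc a₀).ι ≫ (h ≫ gW) = σ ≫ Spec.map (CommRingCat.ofHom (algebraMap R N)) := by
    have h1 : Spec.map (CommRingCat.ofHom (algebraMap R N)) = hW₀'.fromSpec ≫ gW := by
      change Spec.map φ = _
      exact Spec.map_preimage _
    rw [h1, ← hW₀'.isoSpec_inv_ι]
    simp only [σ, Category.assoc, Iso.hom_inv_id_assoc]
    rw [← Category.assoc (h ∣_ Wc a₀), morphismRestrict_ι, Category.assoc]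
  -- the local ring at `j y` is a localisation of the chart ring
  haveI : Nonempty ↥((Wc a₀ : W.Opens) : Scheme.{0}) := ⟨(⟨j y, hwW₀⟩ : Wc a₀)⟩
  haveI : IsDomain N := IsIntegral.component_integral (Wc a₀)
  letI : Algebra N (W.presheaf.stalk (j y)) := W.presheaf.algebra_section_stalk (⟨j y, hwW₀⟩ : Wc a₀)
  haveI : IsLocalization.AtPrime (W.presheaf.stalk (j y)) (hW₀'.primeIdealOf ⟨j y, hwW₀⟩).asIdeal :=
    hW₀'.isLocalization_stalk ⟨j y, hwW₀⟩
  have hrat : HasRationalSingularity (W.presheaf.stalk (j y)) :=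
    hasRationalSingularity_of_chart_of_forall_stalk hdimR.le gW hbirW hproj h hZ Wc hWaff hWcov a₀ hpt
      σ hσ hσT (W.presheaf.stalk (j y)) (hW₀'.primeIdealOf ⟨j y, hwW₀⟩).asIdeal.primeCompl
  exact HasRationalSingularity.of_ringEquiv (asIso (j.stalkMap y)).commRingCatIsoToRingEquiv hrat

/-! ## The print follows from statement B) -/

/-- **Lipman 1969, Proposition (1.2) FOLLOWS FROM statement B) of its proof** (a special case of Zariski's Theorem (26.1)):
part 1) by `hasRationalSingularity_stalk_of_isAffine_of_B` on an affine neighbourhood (hypotheses «normal, codimension two» of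
the point not even needed), part 2) by hand 11's `Lipman1969_1_2_B.hasTrivialCechH1_of_isProper`.
[cite: Lipman1969, Proposition (1.2) (p. 199) and its proof (p. 200), statements A), B)] -/
theorem Lipman1969_1_2_of_B (hB : Lipman1969_1_2_B.{0}) : Lipman1969_1_2.{0} := by
  intro R _ _ _ _ _ hdim hrat W _ g _ _ _ hbir
  refine ⟨fun w _ _ => ?_, fun hWn hprop => ?_⟩
  · -- part 1): an affine neighbourhood of `w`
    obtain ⟨U, hU, hwU, -⟩ : ∃ U : W.Opens, U ∈ W.affineOpens ∧ w ∈ U ∧ U ≤ ⊤ :=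
      (Opens.isBasis_iff_nbhd.mp W.isBasis_affineOpens) (show w ∈ (⊤ : W.Opens) from trivial)
    haveI : IsAffine ((U : W.Opens) : Scheme.{0}) := hU
    haveI : Nonempty ↥((U : W.Opens) : Scheme.{0}) := ⟨(⟨w, hwU⟩ : U)⟩
    haveI : IsIntegral ((U : W.Opens) : Scheme.{0}) := isIntegral_of_isOpenImmersion U.ι
    have hbirU : IsBirational (U.ι ≫ g) := isBirational_ι_comp hbir U ⟨w, hwU⟩
    have h1 := hasRationalSingularity_stalk_of_isAffine_of_B hB hdim hrat (U.ι ≫ g) hbirU ⟨w, hwU⟩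
    exact HasRationalSingularity.of_ringEquiv (asIso (U.ι.stalkMap ⟨w, hwU⟩)).commRingCatIsoToRingEquiv.symm h1
  · -- part 2): hand 11
    haveI := hprop
    exact Lipman1969_1_2_B.hasTrivialCechH1_of_isProper hB hdim hrat g hbir hWn

end Summit.ResolutionOfSingularities.ResolutionOfSingularities.Theorems.NoZeno.RationalAscent

end
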